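import Mathlib.MeasureTheory.Integral.IntegrableOn
import Literature.NumberTheory.Transcendental.KZDominatedFamilyRelations
import Literature.NumberTheory.Transcendental.KZBallPeelingAux
import Literature.NumberTheory.Transcendental.EllIterRep

/-!
# `NormalFormPrinciple` (stmt-KontsevichZagierPeriods-3869), line `SketchIdeator1` —
# stub `slabA_sub_pt_mem_relations`: Newton–Leibniz over the point, algebraic ends

Pure proof file (siege k1, "Mathlib API route"; `--supports` the crux). For real algebraic
`α ≤ β`, an interval representation `N = [(α,β), f]` of the Kontsevich–Zagier calculus whose
integrand `x ↦ f (x 0)` is `ℚ`-semialgebraic on the closed slab, and a `ℚ`-semialgebraic primitive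
`F` of `f` on `(α,β)`, continuous on `[α,β]`, we show `[N] − [pt, F β − F α] ∈ KZ.relations` for
every point representation `[pt, F β − F α]` over `ℝ⁰`.

The chain of moves: ONE Newton–Leibniz move (rule (3) of [Kontsevich–Zagier 2001, §1.2]) from the
closed slab `R = [[α,β], f]` over the base `ℝ⁰` with the fibre primitive `z ↦ F (z 0)` gives
`[R] − [pt, F β − F α] ∈ newtonLeibnizRel`; the closed and open slabs differ by the null set
`{x 0 = α} ∪ {x 0 = β}` (rule (1a), `KZ.IntegralRep.of_sub_of_restrict_mem_relations`); and the
restriction of `R` to the open slab is congruent to `N` (`KZ.of_sub_of_mem_relations_of_eqOn`).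
Integrability of `f` on the closed slab is transported from `N` along the a.e.-equality of the two
slabs (`MeasureTheory.IntegrableOn.congr_set_ae`, `MeasureTheory.ae_eq_set`).

## References

* M. Kontsevich, D. Zagier, *Periods* (2001), §1.2, rules (1) and (3).
* J. Bochnak, M. Coste, M.-F. Roy, *Real Algebraic Geometry* (1998), §2.2.
-/

noncomputable section

open MeasureTheory Set
open Literature.NumberTheory.Transcendental Literature.NumberTheory.Transcendental.KZ
open Literature.ModelTheory.ExponentialFields (IsSemialgebraic isSemialgebraic_univ)

namespace Summit.KontsevichZagierPeriods.HurwitzMicroSectors.NormalFormPrinciple.PiBox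

namespace SlabAK1

/-- **Newton–Leibniz over the point, algebraic ends** (registered sub-goal
`slabA_sub_pt_mem_relations` of crux stmt-KontsevichZagierPeriods-3869). Let `α ≤ β` be real
algebraic, `N = [(α,β), f]` an interval representation whose integrand `x ↦ f (x 0)` is
`ℚ`-semialgebraic on the closed slab, and `F` a primitive of `f` on `(α,β)` which is continuous on
`[α,β]` and `ℚ`-semialgebraic (read on the first coordinate) on the closed slab. Then
`[N] − [pt, F β − F α] ∈ relations` for every point representation over `ℝ⁰` with that constant:
one Newton–Leibniz move (rule 3) on the closed slab over the base `ℝ⁰`, the null endpoints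
(rule 1a) and congruence on the open slab. [cite: KontsevichZagier2001, §1.2 rule (3)] -/
theorem slabA_sub_pt_mem_relations {α β : ℝ} (hα : IsAlgebraic ℚ α) (hβ : IsAlgebraic ℚ β)
    (hαβ : α ≤ β) (f F : ℝ → ℝ)
    (hF : IsSemialgebraicFunOn ℚ {x : Fin 1 → ℝ | x 0 ∈ Set.Icc α β} (fun x => F (x 0)))
    (hFc : ContinuousOn F (Set.Icc α β)) (hderiv : ∀ t ∈ Set.Ioo α β, HasDerivAt F (f t) t)
    (hf : IsSemialgebraicFunOn ℚ {x : Fin 1 → ℝ | x 0 ∈ Set.Icc α β} (fun x => f (x 0)))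
    (N : IntegralRep 1) (hNd : N.domain = {x | x 0 ∈ Set.Ioo α β})
    (hNi : EqOn N.integrand (fun x => f (x 0)) N.domain) (Z : IntegralRep 0) (hZd : Z.domain = univ)
    (hZi : Z.integrand = fun _ => F β - F α) : of N - of Z ∈ relations := by
  -- the closed slab `{α ≤ x₀ ≤ β}` and the open slab `{α < x₀ < β}` are `ℚ`-semialgebraic
  -- (Boolean combinations of open half-lines with algebraic ends), and differ by a null set
  have hCsa : IsSemialgebraic ℚ {x : Fin 1 → ℝ | x 0 ∈ Set.Icc α β} := by
    convert ((isSemialgebraic_setOf_apply_lt_const hα (0 : Fin 1)).union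
      (isSemialgebraic_setOf_const_lt_apply hβ (0 : Fin 1))).compl using 1
    ext x
    simp only [mem_setOf_eq, mem_Icc, mem_compl_iff, mem_union, not_or, not_lt]
  have hOsa : IsSemialgebraic ℚ {x : Fin 1 → ℝ | x 0 ∈ Set.Ioo α β} := by
    convert (isSemialgebraic_setOf_const_lt_apply hα (0 : Fin 1)).inter
      (isSemialgebraic_setOf_apply_lt_const hβ (0 : Fin 1)) using 1
    ext x
    simp only [mem_setOf_eq, mem_Ioo, mem_inter_iff]
  have hOC : {x : Fin 1 → ℝ | x 0 ∈ Set.Ioo α β} ⊆ {x : Fin 1 → ℝ | x 0 ∈ Set.Icc α β} :=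
    fun x hx => Set.Ioo_subset_Icc_self hx
  have hnull : volume ({x : Fin 1 → ℝ | x 0 ∈ Set.Icc α β} \ {x | x 0 ∈ Set.Ioo α β}) = 0 := by
    refine measure_mono_null (fun x hx => ?_)
      (measure_union_null (BallPeeling.volume_setOf_apply_eq_const 1 (0 : Fin 1) α)
        (BallPeeling.volume_setOf_apply_eq_const 1 (0 : Fin 1) β))
    simp only [mem_sdiff, mem_setOf_eq, mem_Icc, mem_Ioo, not_and, not_lt] at hx
    simp only [mem_union, mem_setOf_eq]
    obtain ⟨⟨h1, h2⟩, h3⟩ := hx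
    rcases h1.lt_or_eq with h1 | h1
    · exact Or.inr (le_antisymm h2 (h3 h1))
    · exact Or.inl h1.symm
  -- the integrand `f` on the closed slab is integrable (it is `N.integrand` a.e.)
  have hfi : IntegrableOn (fun x : Fin 1 → ℝ => f (x 0)) {x : Fin 1 → ℝ | x 0 ∈ Set.Icc α β} := by
    have h1 : IntegrableOn (fun x : Fin 1 → ℝ => f (x 0)) N.domain :=
      N.integrableOn.congr_fun hNi (IsSemialgebraic.measurableSet_holds N.isSemialgebraic_domain)
    rw [hNd] at h1
    refine h1.congr_set_ae (ae_eq_set.mpr ⟨hnull, ?_⟩)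
    rw [Set.sdiff_eq_empty.mpr hOC, measure_empty]
  -- the closed-slab representation `R = [[α,β], f]`
  obtain ⟨R, hRd, hRi⟩ : ∃ R : IntegralRep 1, R.domain = {x : Fin 1 → ℝ | x 0 ∈ Set.Icc α β} ∧
      R.integrand = fun x => f (x 0) :=
    ⟨⟨_, fun x => f (x 0), hCsa, hf, hfi⟩, rfl, rfl⟩
  have hs0 : ∀ (x : Fin 0 → ℝ) (t : ℝ), (Fin.snoc x t : Fin 1 → ℝ) 0 = t := fun _ _ => rfl
  -- (i) ONE Newton–Leibniz move over `ℝ⁰`: `[R] − [Z] ∈ newtonLeibnizRel`, primitive `F (z 0)`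
  have hNL : of R - of Z ∈ newtonLeibnizRel := by
    refine ⟨0, R, Z, fun _ => α, fun _ => β, fun z => F (z 0), ?_, ?_, ?_, fun _ _ => hαβ,
      ?_, ?_, ?_, ?_, rfl⟩
    · rw [hRd]
      exact hF
    · rw [hZd]
      exact isSemialgebraicFunOn_const_of_isAlgebraic isSemialgebraic_univ hα
    · rw [hZd]
      exact isSemialgebraicFunOn_const_of_isAlgebraic isSemialgebraic_univ hβ
    · rw [hRd, hZd]
      ext z
      simp only [Set.mem_setOf_eq, Set.mem_Icc, Set.mem_univ, true_and]
      rfl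
    · -- continuity of `t ↦ F t` on the closed fibre
      intro x _
      simp only [hs0]
      exact hFc
    · -- derivative on the open fibre
      intro x _ t ht
      rw [hRi]
      simp only [hs0]
      exact hderiv t ht
    · intro x _
      rw [hZi]
      simp only [hs0]
  -- (ii) closed slab versus the open slab `N.domain` (null endpoints), and congruence with `N`
  have hEsub : {x : Fin 1 → ℝ | x 0 ∈ Set.Ioo α β} ⊆ R.domain := by
    rw [hRd]
    exact hOC
  have hnull' : volume (R.domain \ {x : Fin 1 → ℝ | x 0 ∈ Set.Ioo α β}) = 0 := by
    rw [hRd]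
    exact hnull
  have h2 : of R - of (R.restrict _ hOsa hEsub) ∈ relations :=
    R.of_sub_of_restrict_mem_relations hOsa hEsub hnull'
  have h3 : of (R.restrict _ hOsa hEsub) - of N ∈ relations :=
    of_sub_of_mem_relations_of_eqOn (by rw [hNd]; rfl) fun x hx => by
      rw [IntegralRep.integrand_restrict, hRi, hNi (by rw [hNd]; exact hx)]
  have : of N - of Z = (of R - of Z) - (of R - of (R.restrict _ hOsa hEsub)) -
      (of (R.restrict _ hOsa hEsub) - of N) := by abel
  rw [this]
  exact relations.sub_mem (relations.sub_mem (newtonLeibnizRel_subset_relations hNL) h2) h3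

end SlabAK1

end Summit.KontsevichZagierPeriods.HurwitzMicroSectors.NormalFormPrinciple.PiBox
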